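import Mathlib.Analysis.SpecialFunctions.Exponential
import Literature.Computability.AlgebraicComplexity.STPPWreathTPPGeneral
import Literature.Barriers.MatrixMultiplication.NilpotentGroupBarrierMatchings
import Literature.RepresentationTheory.FiniteGroups.AbelianSubgroupDegreeBound
import HarnessLib

/-!
# CKSU 2005, Thm. 5.5 for an ARBITRARY finite group: `Σᵢ (|Aᵢ||Bᵢ||Cᵢ|)^{ω/3} ≤ Σ_k d_k^ω`

Topic `Literature/Computability/AlgebraicComplexity`; completes the non-abelian GROUP route of
Cohn–Kleinberg–Szegedy–Umans 2005, §7 begun in `WreathCharDegreePowSumGeneral.lean` (Lemma 2) and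
`STPPWreathTPPGeneral.lean` (Thm. 7.1, Lemma 7.2 displayed form).  Source: H. Cohn, R. Kleinberg,
B. Szegedy, C. Umans, *Group-theoretic algorithms for matrix multiplication*, FOCS 2005 = arXiv:math/0511460
(held text `paper:arxiv-math_0511460`, chunks p0009 L132–138 (Thm. 5.5 = arXiv Thm. 31; Lemma 5.4 = arXiv Lemma 30), p0003 (Lemma 1), p0012 L36–77 (proof of Thm. 5.5 in §7)), read this session:

"**Theorem 5.5.** If a group `H` simultaneously realizes `⟨a₁,b₁,c₁⟩, …, ⟨a_n,b_n,c_n⟩` and has character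
degrees `{d_k}`, then `Σᵢ (aᵢbᵢcᵢ)^{ω/3} ≤ Σ_k d_k^ω`."  "*Proof of Theorem 5.5* [§7]. Let `Aᵢ', Bᵢ', Cᵢ'` be
the `N`-fold direct product of the triples `Aᵢ, Bᵢ, Cᵢ` (via Lemma 5.4), and let `μ` be an arbitrary
`n`-vector of nonnegative integers for which `Σᵢ μᵢ = N`. Among the triples `Aᵢ', Bᵢ', Cᵢ'` are
`M = binom(N, μ)` triples for which `|Aᵢ'||Bᵢ'||Cᵢ'| = ∏ᵢ (aᵢbᵢcᵢ)^{μᵢ}`; call this quantity `L`. Using these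
triples in Theorem 7.1, we obtain subsets `H₁, H₂, H₃` with `|H₁||H₂||H₃| = (M!)³L^M`. Applying Theorem 1.8
and Lemma 2 we get `((M!)³L^M)^{ω/3} ≤ (M!)^{ω−1}(Σ_k d_k^ω)^{NM}`. Taking `M`-th roots and letting
`N → ∞` yields `binom(N,μ) (∏ᵢ (aᵢbᵢcᵢ)^{μᵢ})^{ω/3} ≤ (Σ_k d_k^ω)^N`. Finally, we apply Lemma 1
[`binom(N,μ) ∏ sᵢ^{μᵢ} ≤ C^N` for all `μ` ⇒ `Σ sᵢ ≤ C`] with `sᵢ = (aᵢbᵢcᵢ)^{ω/3}` and `C = Σ_k d_k^ω`."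

## Results (all proved; no named fact)

* `SimultaneousTPP.card_mul_rpow_le_exp_mul_of_uniform` — the uniform step for `M` STPP triples of equal
  volume `L` in a finite group `G`: `M · L^{ω/3} ≤ e · Σ_{Irr G} χ(1)^ω`.  (Printed: "taking `M`-th roots"
  of `M!·L^{Mω/3} ≤ (Σ_j c_j^ω-bound)^M`; we use `M^M/M! ≤ e^M`, Mathlib `Real.pow_div_factorial_le_exp`,
  so the constant `e` appears instead of the limit `N → ∞` inside the type — it is absorbed by the final
  tensor-power step exactly like CKSU's Lemma 1.)
* `CohnKleinbergSzegedyUmans2005_thm55_general` — **Thm. 5.5 for every finite group `H`**: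
  `Σᵢ (|Aᵢ||Bᵢ||Cᵢ|)^{ω/3} ≤ charDegreePowSum H ω` for every STPP family `(Aᵢ, Bᵢ, Cᵢ)_{i<n}` (the tree's
  multiplicative `SimultaneousTPP`, CKSU Def. 5.1 verbatim).  Architecture as printed: direct powers
  (`SimultaneousTPP.pi`, Lemma 5.4), types `μ`, the uniform step on each type class
  (`SimultaneousTPP.comp`), `Σ_{Irr(H^N)} = (Σ_{Irr H})^N` (`charDegreePowSum_pi_fin`), the count of types
  `≤ (N+1)ⁿ` and `N → ∞` (`Combinatorics.le_of_pow_le_poly_mul_pow`, the tree's form of Lemma 1).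
  The abelian case (`Σ_k d_k^ω = |H|`) is the tree's `CohnKleinbergSzegedyUmans2005_5_5_abelian_holds`
  (tensor route); this file is the printed group route, for all finite `H`.
* `CohnKleinbergSzegedyUmans2005_lemma39_general` — **Lemma 7.2 (arXiv Lemma 39) as printed** (geometric mean),
  for every finite `H`, read off Thm. 5.5 by AM–GM.
* `CohnKleinbergSzegedyUmans2005_thm55_general_maxCharDegree` / `…_abelianSubgroup` — the applied forms
  `Σᵢ (|Aᵢ||Bᵢ||Cᵢ|)^{ω/3} ≤ d_max^{ω−2}|H| ≤ [H:N]^{ω−2}|H|` (Cor. 1.9's estimate; `N` an abelian subgroup,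
  CKSU §1.2 / Serre §3.1 Cor.), ready for census groups with an abelian subgroup of small index.

## References

* [CohnKleinbergSzegedyUmans2005] FOCS 2005 = arXiv:math/0511460: Thm. 5.5 (arXiv Thm. 31), Lemma 1,
  Lemma 5.4 (arXiv Lemma 30), and the proof of Thm. 5.5 in §7 (p. 12 of the held text).
-/

noncomputable section

namespace Literature.Computability.AlgebraicComplexity

open Finset Literature.RepresentationTheory.FiniteGroups Literature.Combinatorics.Additive
open Literature.Barriers.MatrixMultiplication (card_le_charDegreePowSum)

/-! ### The uniform step -/

/-- **Uniform STPP families** (the step "`((M!)³L^M)^{ω/3} ≤ (M!)^{ω−1}(Σ c^ω)^{M}` … taking `M`-th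
roots" of the proof of CKSU Thm. 5.5, for a family whose `M` triples all have `|Aᵢ||Bᵢ||Cᵢ| = L`, in any
finite group `G`): `M · L^{ω/3} ≤ e · Σ_{χ ∈ Irr G} χ(1)^ω`.  From `M! · L^{Mω/3} ≤ (Σ_χ χ(1)^ω)^M`
(`CohnKleinbergSzegedyUmans2005_lemma39_weak_general`) and `M^M ≤ e^M · M!`.
[cite: CohnKleinbergSzegedyUmans2005, Thm. 5.5 (proof, §7)] -/
theorem _root_.Literature.Combinatorics.Additive.SimultaneousTPP.card_mul_rpow_le_exp_mul_of_uniform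
    {G : Type} [Group G] [Fintype G] [DecidableEq G] {M : ℕ} {A B C : Fin M → Finset G}
    (hS : SimultaneousTPP A B C) {L : ℕ} (hL : ∀ i, (A i).card * (B i).card * (C i).card = L) :
    (M : ℝ) * (L : ℝ) ^ (omega ℂ / 3) ≤ Real.exp 1 * charDegreePowSum G (omega ℂ) := by
  have h39 := CohnKleinbergSzegedyUmans2005_lemma39_weak_general hS
  have hprod : (∏ i, ((A i).card * (B i).card * (C i).card)) = L ^ M := by
    rw [Finset.prod_congr rfl (fun i _ => hL i), Finset.prod_const, Finset.card_univ, Fintype.card_fin]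
  rw [hprod, Nat.cast_pow] at h39
  set S := charDegreePowSum G (omega ℂ) with hSdef
  have hSpos : 0 < S := lt_of_lt_of_le (by exact_mod_cast (Fintype.card_pos (α := G)))
    (card_le_charDegreePowSum G (omega_two_le ℂ))
  have hLnn : (0 : ℝ) ≤ (L : ℝ) := Nat.cast_nonneg _
  set x : ℝ := (L : ℝ) ^ (omega ℂ / 3) with hx
  have hxnn : 0 ≤ x := Real.rpow_nonneg hLnn _
  -- `h39 : M! · x^M ≤ S^M`
  have h39' : (M.factorial : ℝ) * x ^ M ≤ S ^ M := by
    have : ((L : ℝ) ^ M) ^ (omega ℂ / 3) = x ^ M := by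
      rw [hx, ← Real.rpow_natCast, ← Real.rpow_natCast, ← Real.rpow_mul hLnn, ← Real.rpow_mul hLnn,
        mul_comm]
    rw [this] at h39
    exact h39
  rcases Nat.eq_zero_or_pos M with hM | hM
  · subst hM; simp only [Nat.cast_zero, zero_mul]; positivity
  -- `(M x)^M = M^M x^M ≤ e^M M! x^M ≤ (e S)^M`
  have hfact : (M : ℝ) ^ M ≤ Real.exp 1 ^ M * M.factorial := by
    have h := Real.pow_div_factorial_le_exp (M : ℝ) (Nat.cast_nonneg M) M
    rw [div_le_iff₀ (by exact_mod_cast Nat.factorial_pos M)] at h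
    calc (M : ℝ) ^ M ≤ Real.exp M * M.factorial := h
      _ = Real.exp 1 ^ M * M.factorial := by rw [← Real.exp_one_pow]
  have hpow : ((M : ℝ) * x) ^ M ≤ (Real.exp 1 * S) ^ M := by
    calc ((M : ℝ) * x) ^ M = (M : ℝ) ^ M * x ^ M := mul_pow _ _ _
      _ ≤ Real.exp 1 ^ M * M.factorial * x ^ M := mul_le_mul_of_nonneg_right hfact (pow_nonneg hxnn M)
      _ = Real.exp 1 ^ M * ((M.factorial : ℝ) * x ^ M) := by ring
      _ ≤ Real.exp 1 ^ M * S ^ M := mul_le_mul_of_nonneg_left h39' (pow_nonneg (Real.exp_pos 1).le M)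
      _ = (Real.exp 1 * S) ^ M := (mul_pow _ _ _).symm
  exact (pow_le_pow_iff_left₀ (mul_nonneg (Nat.cast_nonneg _) hxnn)
    (mul_nonneg (Real.exp_pos 1).le hSpos.le) hM.ne').mp hpow

/-! ### Theorem 5.5 for an arbitrary finite group -/

/-- **Cohn–Kleinberg–Szegedy–Umans 2005, Thm. 5.5, for an ARBITRARY finite group `H`** with character
degrees `{d_k}`: if `(Aᵢ, Bᵢ, Cᵢ)_{i<n}` satisfy the simultaneous triple product property in `H`, then
`Σᵢ (|Aᵢ||Bᵢ||Cᵢ|)^{ω/3} ≤ Σ_k d_k^ω` (`= charDegreePowSum H ω`).  Proof with the printed architecture (§7):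
direct powers `H^N` (Lemma 5.4, `SimultaneousTPP.pi`), words sorted by type `μ`, each type class a uniform
STPP sub-family of `M_μ` triples of volume `L_μ = ∏ᵢ (|Aᵢ||Bᵢ||Cᵢ|)^{μᵢ}` (`SimultaneousTPP.comp`) with
`M_μ L_μ^{ω/3} ≤ e (Σ_k d_k^ω)^N` (uniform step and `charDegreePowSum_pi_fin`), at most `(N+1)ⁿ` types:
`(Σᵢ (|Aᵢ||Bᵢ||Cᵢ|)^{ω/3})^N ≤ e (N+1)ⁿ (Σ_k d_k^ω)^N` for every `N`, whence the claim (Lemma 1 /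
`Combinatorics.le_of_pow_le_poly_mul_pow`). [cite: CohnKleinbergSzegedyUmans2005, Thm. 5.5 (arXiv Thm. 31)] -/
theorem CohnKleinbergSzegedyUmans2005_thm55_general {H : Type} [Group H] [Fintype H] [DecidableEq H]
    {n : ℕ} {A B C : Fin n → Finset H} (hS : SimultaneousTPP A B C) :
    ∑ i, (((A i).card * (B i).card * (C i).card : ℕ) : ℝ) ^ (omega ℂ / 3) ≤
      charDegreePowSum H (omega ℂ) := by
  classical
  set S := charDegreePowSum H (omega ℂ) with hSdef
  have hSpos : 0 < S := lt_of_lt_of_le (by exact_mod_cast (Fintype.card_pos (α := H)))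
    (card_le_charDegreePowSum H (omega_two_le ℂ))
  refine Combinatorics.le_of_pow_le_poly_mul_pow (c := Real.exp 1) (d := n) hSpos fun N _hN => ?_
  -- sizes and types
  set sz : Fin n → ℕ := fun i => (A i).card * (B i).card * (C i).card with hsz
  let T : (Fin N → Fin n) → (Fin n → ℕ) := fun w i => (univ.filter fun c => w c = i).card
  let Lμ : (Fin n → ℕ) → ℕ := fun μ => ∏ i, sz i ^ μ i
  have hprodT : ∀ w : Fin N → Fin n, ∏ c, sz (w c) = Lμ (T w) := by
    intro w
    rw [← Finset.prod_fiberwise univ w (fun c => sz (w c))]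
    refine prod_congr rfl fun j _ => ?_
    rw [prod_congr rfl (fun c hc => by rw [(mem_filter.1 hc).2]), prod_const]
  -- (1) expand the `N`-th power of the sum over words
  have hexp : (∑ i, ((sz i : ℕ) : ℝ) ^ (omega ℂ / 3)) ^ N =
      ∑ w : Fin N → Fin n, ((Lμ (T w) : ℕ) : ℝ) ^ (omega ℂ / 3) := by
    rw [Finset.sum_pow', Fintype.piFinset_univ]
    refine sum_congr rfl fun w _ => ?_
    rw [Real.finsetProd_rpow _ _ (fun c _ => by positivity), ← hprodT w]
    push_cast
    rfl
  -- (2) the direct power family (Lemma 5.4), indexed by words `Fin N → Fin n`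
  set A' : (Fin N → Fin n) → Finset (Fin N → H) := fun w => Fintype.piFinset fun c => A (w c) with hA'
  set B' : (Fin N → Fin n) → Finset (Fin N → H) := fun w => Fintype.piFinset fun c => B (w c) with hB'
  set C' : (Fin N → Fin n) → Finset (Fin N → H) := fun w => Fintype.piFinset fun c => C (w c) with hC'
  have hS' : SimultaneousTPP A' B' C' := hS.pi
  have hsize : ∀ w : Fin N → Fin n, (A' w).card * (B' w).card * (C' w).card = Lμ (T w) := by
    intro w
    rw [← hprodT w, hA', hB', hC']
    simp only [Fintype.card_piFinset, ← prod_mul_distrib, hsz]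
  -- (3) each type class is a uniform STPP sub-family: `M_μ · L_μ^{ω/3} ≤ e · S^N`
  have hpow : charDegreePowSum (Fin N → H) (omega ℂ) = S ^ N := charDegreePowSum_pi_fin H (omega ℂ) N
  have hfiber : ∀ μ : Fin n → ℕ,
      ((univ.filter fun w : Fin N → Fin n => T w = μ).card : ℝ) * ((Lμ μ : ℕ) : ℝ) ^ (omega ℂ / 3) ≤
        Real.exp 1 * S ^ N := by
    intro μ
    set F := univ.filter fun w : Fin N → Fin n => T w = μ with hF
    set e : Fin F.card ≃ {w // w ∈ F} := F.equivFin.symm with he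
    set ι : Fin F.card → (Fin N → Fin n) := fun k => (e k).1 with hι
    have hιinj : Function.Injective ι := fun k k' hkk' => e.injective (Subtype.ext hkk')
    have hsub : SimultaneousTPP (A' ∘ ι) (B' ∘ ι) (C' ∘ ι) := hS'.comp hιinj
    have hunif : ∀ k : Fin F.card,
        ((A' ∘ ι) k).card * ((B' ∘ ι) k).card * ((C' ∘ ι) k).card = Lμ μ := by
      intro k
      have hk : T (e k).1 = μ := (mem_filter.1 (e k).2).2
      rw [Function.comp_apply, Function.comp_apply, Function.comp_apply, hι]
      simp only
      rw [hsize, hk]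
    have h := hsub.card_mul_rpow_le_exp_mul_of_uniform hunif
    rw [hpow] at h
    exact h
  -- (4) group the words by type and count the types
  have htypes : ((univ : Finset (Fin N → Fin n)).image T).card ≤ (N + 1) ^ n := by
    have hsubset : (univ : Finset (Fin N → Fin n)).image T ⊆
        Fintype.piFinset fun _ : Fin n => range (N + 1) := by
      intro μ hμ
      rw [mem_image] at hμ
      obtain ⟨w, -, rfl⟩ := hμ
      rw [Fintype.mem_piFinset]
      intro i
      rw [mem_range, Nat.lt_succ_iff]
      exact (card_filter_le _ _).trans (by rw [card_univ, Fintype.card_fin])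
    refine (card_le_card hsubset).trans ?_
    rw [Fintype.card_piFinset, prod_const, card_range, card_univ, Fintype.card_fin]
  have heS : 0 ≤ Real.exp 1 * S ^ N := mul_nonneg (Real.exp_pos 1).le (pow_nonneg hSpos.le N)
  calc (∑ i, ((sz i : ℕ) : ℝ) ^ (omega ℂ / 3)) ^ N
      = ∑ w : Fin N → Fin n, ((Lμ (T w) : ℕ) : ℝ) ^ (omega ℂ / 3) := hexp
    _ = ∑ μ ∈ (univ : Finset (Fin N → Fin n)).image T,
          (univ.filter fun w : Fin N → Fin n => T w = μ).card •
            ((Lμ μ : ℕ) : ℝ) ^ (omega ℂ / 3) :=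
        Finset.sum_comp (fun μ => ((Lμ μ : ℕ) : ℝ) ^ (omega ℂ / 3)) T
    _ ≤ ∑ _μ ∈ (univ : Finset (Fin N → Fin n)).image T, Real.exp 1 * S ^ N := by
        refine sum_le_sum fun μ _ => ?_
        rw [nsmul_eq_mul]
        exact hfiber μ
    _ = (((univ : Finset (Fin N → Fin n)).image T).card : ℝ) * (Real.exp 1 * S ^ N) := by
        rw [sum_const, nsmul_eq_mul]
    _ ≤ (((N + 1) ^ n : ℕ) : ℝ) * (Real.exp 1 * S ^ N) := by
        gcongr
    _ = Real.exp 1 * ((N : ℝ) + 1) ^ n * S ^ N := by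
        push_cast
        ring

/-- **Cohn–Kleinberg–Szegedy–Umans 2005, Lemma 7.2 (arXiv Lemma 39) as printed, for an ARBITRARY finite group
`H`** with character degrees `{d_k}`: for an STPP family `(Aᵢ, Bᵢ, Cᵢ)_{i<n}`,
`n · (∏ᵢ (|Aᵢ||Bᵢ||Cᵢ|)^{ω/3})^{1/n} ≤ Σ_k d_k^ω` ("a weaker bound, with the geometric mean replacing the
arithmetic mean"); here read off Thm. 5.5 by the AM–GM inequality (the printed proof instead tensors up the
displayed `(n!)^{−1}` form, `CohnKleinbergSzegedyUmans2005_lemma39_weak_general`).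
[cite: CohnKleinbergSzegedyUmans2005, Lemma 7.2 (arXiv Lemma 39)] -/
theorem CohnKleinbergSzegedyUmans2005_lemma39_general {H : Type} [Group H] [Fintype H] [DecidableEq H]
    {n : ℕ} {A B C : Fin n → Finset H} (hS : SimultaneousTPP A B C) :
    (n : ℝ) * (∏ i, (((A i).card * (B i).card * (C i).card : ℕ) : ℝ) ^ (omega ℂ / 3)) ^ ((1 : ℝ) / n) ≤
      charDegreePowSum H (omega ℂ) := by
  have h55 := CohnKleinbergSzegedyUmans2005_thm55_general hS
  rcases Nat.eq_zero_or_pos n with hn | hn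
  · subst hn
    rw [Nat.cast_zero, zero_mul]
    simpa using h55
  set z : Fin n → ℝ := fun i => (((A i).card * (B i).card * (C i).card : ℕ) : ℝ) ^ (omega ℂ / 3) with hz
  have hz0 : ∀ i, 0 ≤ z i := fun i => by rw [hz]; positivity
  have hnR : (0 : ℝ) < n := by exact_mod_cast hn
  have hamgm := Real.geom_mean_le_arith_mean_weighted (univ : Finset (Fin n)) (fun _ => (1 : ℝ) / n) z
    (fun _ _ => by positivity) (by rw [sum_const, card_univ, Fintype.card_fin, nsmul_eq_mul]; field_simp)
    (fun i _ => hz0 i)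
  rw [Real.finsetProd_rpow _ _ (fun i _ => hz0 i), ← Finset.mul_sum] at hamgm
  calc (n : ℝ) * (∏ i, z i) ^ ((1 : ℝ) / n) ≤ (n : ℝ) * ((1 : ℝ) / n * ∑ i, z i) :=
        mul_le_mul_of_nonneg_left hamgm hnR.le
    _ = ∑ i, z i := by field_simp
    _ ≤ charDegreePowSum H (omega ℂ) := h55

/-! ### The forms in which the bound "is generally applied" (largest character degree; abelian subgroups) -/

/-- **Thm. 5.5 (arbitrary finite `H`) in the `d_max` form of CKSU Cor. 1.9** ("Suppose `G` … has largest
character degree `d`. Then `(nmp)^{ω/3} ≤ d^{ω−2}|G|"): for an STPP family,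
`Σᵢ (|Aᵢ||Bᵢ||Cᵢ|)^{ω/3} ≤ d_max^{ω−2} · |H|`, combining `CohnKleinbergSzegedyUmans2005_thm55_general` with
`Σ_k d_k^ω ≤ d_max^{ω−2} Σ_k d_k² = d_max^{ω−2}|H|` (tree `charDegreePowSum_le_maxCharDegree_rpow_mul_card`).
[cite: CohnKleinbergSzegedyUmans2005, Thm. 5.5 (arXiv Thm. 31) and Cor. 1.9] -/
theorem CohnKleinbergSzegedyUmans2005_thm55_general_maxCharDegree {H : Type} [Group H] [Fintype H]
    [DecidableEq H] {n : ℕ} {A B C : Fin n → Finset H} (hS : SimultaneousTPP A B C) :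
    ∑ i, (((A i).card * (B i).card * (C i).card : ℕ) : ℝ) ^ (omega ℂ / 3) ≤
      (maxCharDegree H : ℝ) ^ (omega ℂ - 2) * Fintype.card H := by
  have h := (CohnKleinbergSzegedyUmans2005_thm55_general hS).trans
    (charDegreePowSum_le_maxCharDegree_rpow_mul_card H (omega_two_le ℂ))
  rwa [Nat.card_eq_fintype_card] at h

/-- **Thm. 5.5 (arbitrary finite `H`) for a group with an abelian subgroup `N` of index `t`**:
`Σᵢ (|Aᵢ||Bᵢ||Cᵢ|)^{ω/3} ≤ t^{ω−2} · |H|`, since "if `G` has an abelian subgroup `A`, then all the character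
degrees of `G` are less than or equal to the index `[G:A]`" (CKSU §1.2, citing Prop. 2.6 of [H]; tree
`maxCharDegree_le_index`, Serre §3.1 Cor.).  The form used for dihedral-like / index-`t` census groups.
[cite: CohnKleinbergSzegedyUmans2005, Thm. 5.5 (arXiv Thm. 31), Cor. 1.9 and §1.2 (degrees ≤ [G:A])] -/
theorem CohnKleinbergSzegedyUmans2005_thm55_general_abelianSubgroup {H : Type} [Group H] [Fintype H]
    [DecidableEq H] {n : ℕ} {A B C : Fin n → Finset H} (hS : SimultaneousTPP A B C)
    (N : Subgroup H) [IsMulCommutative N] :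
    ∑ i, (((A i).card * (B i).card * (C i).card : ℕ) : ℝ) ^ (omega ℂ / 3) ≤
      (N.index : ℝ) ^ (omega ℂ - 2) * Fintype.card H := by
  haveI : N.FiniteIndex := Subgroup.finiteIndex_of_finite
  refine (CohnKleinbergSzegedyUmans2005_thm55_general_maxCharDegree hS).trans ?_
  refine mul_le_mul_of_nonneg_right ?_ (Nat.cast_nonneg _)
  exact Real.rpow_le_rpow (Nat.cast_nonneg _) (by exact_mod_cast maxCharDegree_le_index N)
    (sub_nonneg.2 (omega_two_le (K := ℂ)))

end Literature.Computability.AlgebraicComplexity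

end
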